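import Summits.Ventures.PercRepro.Night2NonFatLine

/-!
# night-2: the NON-FAT case of (FAIR) — with four active faces every point of `W` is a hole (gen 37)

The companion of `dead_mem_clF_of_three`: a point of `W` in the closures of the faces `Q.erase w` for all `w ∈ A` lies in
`cl (Q ∖ A)`; when `A` has four points of the basis `Q ∖ K`, `Q ∖ A` is `K` plus one basis point `a`, whose closure meets
`V = G ∖ K` in `{a}` alone (simplicity) — no point of `W`.  So **`exists_notMem_clF_erase_of_four_le`**: with at least four
active faces every point of `W` is a hole of some active face; the dichotomy of the non-fat lossy pairs is complete: three
active faces (dead points on the basis line `cl (Q ∖ A)`, the nested-line geometry) or at least four (every point of `W`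
off some active hyperplane, `|W| ≤ Σ_{w ∈ A} (m_w − 1)`).
Paper: proofs/NIGHT-2-g37.md §4.
-/

namespace PercRepro.Shadow

open PercRepro.ThmH PercRepro.PerFlat

variable {α : Type*} [DecidableEq α] {M : Matroid α} [M.Finite] {G : Finset α}

/-- In a simple matroid a point `y` of `gr M` in the closure of `{a}` is `a` itself. -/
theorem eq_of_mem_clF_singleton (hs : ∀ e ∈ gr M, ∀ f ∈ gr M, e ≠ f → rkN M {e, f} = 2) {a y : α}
    (ha : a ∈ gr M) (hy : y ∈ gr M) (hcl : y ∈ clF M {a}) : y = a := by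
  by_contra hne
  have hya := hs y hy a ha hne
  have h3 : rkN M (insert y {a}) ≤ rkN M {a} :=
    rkN_insert_le_of_mem_clF (Finset.singleton_subset_iff.2 ha) hcl
  have h4 := rkN_le_card (M := M) {a}
  rw [Finset.card_singleton] at h4
  rw [hya] at h3
  omega

/-- In a simple matroid no point of `gr M` lies in the closure of `∅` (a second point gives rank `2`). -/
theorem notMem_clF_empty (hs : ∀ e ∈ gr M, ∀ f ∈ gr M, e ≠ f → rkN M {e, f} = 2) {y w : α}
    (hy : y ∈ gr M) (hw : w ∈ gr M) (hne : y ≠ w) (hcl : y ∈ clF M ∅) : False := by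
  have hyw := hs y hy w hw hne
  have h1 : rkN M (insert y ∅) ≤ rkN M ∅ := rkN_insert_le_of_mem_clF (Finset.empty_subset _) hcl
  have h2 := rkN_le_card (M := M) ∅
  rw [Finset.card_empty] at h2
  have h3 : rkN M (insert w (insert y ∅)) ≤ rkN M (insert y ∅) + 1 := by
    have := rkN_union_le_add_card (M := M) (insert y ∅) {w}
    rw [Finset.card_singleton] at this
    rw [Finset.insert_eq w, Finset.union_comm]
    exact this
  have h4 : ({y, w} : Finset α) = insert w (insert y ∅) := by
    ext e
    simp only [Finset.mem_insert, Finset.mem_singleton, Finset.notMem_empty, or_false]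
    tauto
  rw [h4] at hyw
  omega

/-- **With four active faces every point of `W` is a hole of one of them**: otherwise `y ∈ cl (Q ∖ A)` with `Q ∖ A ⊆ K ∪ {a}`
for a single basis point `a`, so `y ∈ cl {a}` or `y ∈ cl ∅` — impossible in a simple matroid. -/
theorem exists_notMem_clF_erase_of_four_le (hG : G ∈ flatsQ M (5 + 1)) (hd : (gr M \ G).card = 2)
    (hk : kColoops M G = 1) (hs : ∀ e ∈ gr M, ∀ f ∈ gr M, e ≠ f → rkN M {e, f} = 2) {B : Finset α}
    (hB : B ∈ thinMembers M 5 G) (hnP : ¬ bigP M G B) {z : α} (hz : z ∈ G \ clF M B) {A : Finset α}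
    (hA : A ⊆ insert z B \ coloops M G) (h4 : 4 ≤ A.card) {y : α} (hy : y ∈ G \ insert z B) :
    ∃ w ∈ A, y ∉ clF M ((insert z B).erase w) := by
  by_contra hall
  push Not at hall
  have hd' : (gr M \ G).card ≤ 5 := by omega
  have hGg : G ⊆ gr M := (mem_flatsQ.1 hG).1
  have hKB : coloops M G ⊆ B := coloops_subset_of_mem_thinMembers hG hd' hB
  have hBG : B ⊆ G := subset_G_of_mem_thinMembers hB
  have hQG : insert z B ⊆ G := Finset.insert_subset (Finset.mem_sdiff.1 hz).1 hBG
  have hyG : y ∈ G := (Finset.mem_sdiff.1 hy).1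
  have hyQ : y ∉ insert z B := (Finset.mem_sdiff.1 hy).2
  have hcl := dead_mem_clF_of_three hG hd hk hB hnP hz (hA.trans Finset.sdiff_subset) hyG hall
  have hyV : y ∈ G \ coloops M G :=
    Finset.mem_sdiff.2 ⟨hyG, fun hK => hyQ (Finset.mem_insert_of_mem (hKB hK))⟩
  -- `y ∈ cl R`, `R = (Q ∖ A) ∖ K` the basis points off `A`, at most one
  have hR : y ∈ clF M ((insert z B \ A) \ coloops M G) :=
    mem_clF_sdiff_coloops_of_mem_clF hG hk (Finset.sdiff_subset.trans hQG) hyV hcl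
  have hQ'card : (insert z B \ coloops M G).card = 5 := by
    have h4' := card_sdiff_eq_four_of_not_bigP hG hd hk hB hnP
    have hzB : z ∉ B := fun h => (Finset.mem_sdiff.1 hz).2 (subset_clF_of_subset_gr (hBG.trans hGg) h)
    have h1 : insert z B \ coloops M G = insert z (B \ coloops M G) := by
      ext e
      simp only [Finset.mem_sdiff, Finset.mem_insert]
      constructor
      · rintro ⟨h | h, hK⟩
        · exact Or.inl h
        · exact Or.inr ⟨h, hK⟩
      · rintro (rfl | ⟨h, hK⟩)
        · exact ⟨Or.inl rfl, fun hK => hzB (hKB hK)⟩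
        · exact ⟨Or.inr h, hK⟩
    rw [h1, Finset.card_insert_of_notMem (fun h => hzB (Finset.mem_sdiff.1 h).1), h4']
  have hReq : (insert z B \ A) \ coloops M G = (insert z B \ coloops M G) \ A := by
    ext e
    simp only [Finset.mem_sdiff]
    tauto
  have hRcard : ((insert z B \ A) \ coloops M G).card ≤ 1 := by
    rw [hReq, Finset.card_sdiff_of_subset hA]
    omega
  obtain ⟨w, hwA⟩ : A.Nonempty := Finset.card_pos.1 (by omega)
  have hwQ : w ∈ insert z B := (Finset.mem_sdiff.1 (hA hwA)).1
  have hyw : y ≠ w := fun h => hyQ (h ▸ hwQ)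
  by_cases hemp : (insert z B \ A) \ coloops M G = ∅
  · rw [hemp] at hR
    exact notMem_clF_empty hs (hGg hyG) (hGg (hQG hwQ)) hyw hR
  · obtain ⟨b, hb⟩ := Finset.nonempty_iff_ne_empty.2 hemp
    have hsub : (insert z B \ A) \ coloops M G ⊆ {b} := by
      intro e he
      rw [Finset.mem_singleton]
      exact Finset.card_le_one.1 hRcard e he b hb
    have hbQ : b ∈ insert z B := (Finset.mem_sdiff.1 (Finset.mem_sdiff.1 hb).1).1
    have hcl' : y ∈ clF M {b} := clF_mono hsub hR
    have := eq_of_mem_clF_singleton hs (hGg (hQG hbQ)) (hGg hyG) hcl'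
    exact hyQ (this ▸ hbQ)

end PercRepro.Shadow
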